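import Mathlib
import Literature.NumberTheory.Transcendental.ZagierDilogarithmConjecture
import Literature.NumberTheory.Transcendental.BlochWignerDilogarithm
import Literature.NumberTheory.Transcendental.BlochWignerDilogarithmProofs
import Summits.KontsevichZagierPeriods.KontsevichZagierPeriods.Theorems.HyperbolicBlochZagierDilogarithmConjectureStubAbelianPropagation
import Summits.KontsevichZagierPeriods.KontsevichZagierPeriods.Theorems.HyperbolicBlochZagierDilogarithmConjectureStubGaloisSubSector
import Summits.KontsevichZagierPeriods.KontsevichZagierPeriods.Theorems.HyperbolicBlochZagierDilogarithmConjectureStubSexticKZ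
import HarnessLib

/-!
# `ZagierDilogarithmConjecture` (stmt-KontsevichZagierPeriods-10550) — line `kummer-clausen-linearisation`
(reshape c5, "the cyclotomic tower and the abelian sector"), stub `stub_abelianKZ_of_milnor`

**The abelian Dehn-zero sub-sector of Kontsevich–Zagier's Conjecture 1 on ideal tetrahedra, route level,
mod Dupont + Borel rank + Milnor_N.** Notation: `ζ_N = e^{2πi/N}`, `D = blochWignerDilog` the Bloch–Wigner
dilogarithm, `T(z)` the ideal tetrahedron of `ℍ³` with vertices `0, 1, z, ∞` (upper half-space model, the
hypothesis on `T` is verbatim its defining region), `ρ z = [T(z), t⁻³]` the standard Kontsevich–Zagier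
integral representations of its volume (domain `T z`, integrand `t⁻³` on `T z`, for algebraic `z ∈ ℍ⁺`),
`dehn u v` the Dehn-type invariants of `Negative/DehnInvariant`.

What the route's deciding theorem `closes` consumes from the crux is TetraSector's conclusion: every
`ℤ`-relation `Σ nᵢ · value(ρ zᵢ) = 0` among the periods `vol T(zᵢ)` of ideal tetrahedra with algebraic
shapes `zᵢ ∈ ℍ⁺` is a KZ relation, `Σ nᵢ[ρ zᵢ] ∈ KZ.relations`. This file proves that conclusion on the
ABELIAN DEHN-ZERO SECTOR — cyclotomic points `zᵢ = Σₘ qᵢₘ ζ_Nᵐ ∈ ℚ(ζ_N) ∩ ℍ⁺` whose formal combination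
`Σ nᵢ[zᵢ]` has all Dehn invariants zero — GIVEN, as explicit hypotheses (never unfolded),
(1) Dupont 2001 Thm. 10.24 a) (`Dupont2001_preBloch_relation_of_invariants`), (2) Borel's rank theorem for
the Bloch group (`Borel1977_blochGroup_rank_le`, Neumann 1998 Thm. 3.2) and (3) Milnor's conjecture at
level `N` in `ℤ`-form (the Clausen values `D(ζ_N^c)`, `(c, N) = 1`, `0 < c < N/2`, admit only the trivial
`ℤ`-relation).

Proof (a three-line composition of landed theorems).
* The cyclotomic points are algebraic (`AbelianSector.isAlgebraic_cyclotomicSum`), so VALUES ARE VOLUMES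
  ARE DILOGARITHMS: `value(ρ zᵢ) = vol T(zᵢ) = D(zᵢ)` (`SexticKZ.value_eq_blochWignerDilog`, Milnor's
  computation of the volume of an ideal tetrahedron); the hypothesis becomes `Σ nᵢ D(zᵢ) = 0`.
* ABELIAN PROPAGATION (`stub_abelianPropagation`, the lead's, mod Borel rank + Milnor_N): the Dehn-zero
  relation propagates to every Galois twist, `Σ nᵢ (D(σ zᵢ) − D(σ z̄ᵢ)) = 0` for all `σ : ℚ̄ →ₐ[ℚ] ℂ`.
* GALOIS SUB-SECTOR (`ZagierDilogarithmGaloisDescent.stub_galoisSubSector`, c2, mod Dupont): algebraic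
  shapes in `ℍ⁺` with zero Dehn invariant and vanishing Galois-twisted odd volumes give a KZ relation for
  the standard representations.
Sorry-free; axioms ⊆ {propext, Classical.choice, Quot.sound}; conditional only on the three explicit
antecedents.

## References

* M. Kontsevich, D. Zagier, *Periods*, in: Mathematics Unlimited — 2001 and Beyond, Springer (2001), §1.2
  (Conjecture 1; the example of hyperbolic volumes). [KontsevichZagier2001]
* W. D. Neumann, *Hilbert's 3rd problem and invariants of 3-manifolds*, Geom. Topol. Monogr. 1 (1998),
  §2.1, Thm. 3.2. [Neumann1998]
* J. Milnor, *Hyperbolic geometry: the first 150 years*, Bull. AMS 6 (1982), Appendix. [Milnor1982]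
* J. L. Dupont, *Scissors congruences, group homology and characteristic classes*, World Scientific
  (2001), Thm. 10.24 a). [Dupont2001]
-/

noncomputable section

open scoped BigOperators ComplexConjugate
open Literature.NumberTheory.Transcendental
open Summit.KontsevichZagierPeriods.HyperbolicBloch.ZagierDilogarithmConjectureNegative (dehn)
open Summit.KontsevichZagierPeriods.HyperbolicBloch.ZagierDilogarithmGaloisDescent (stub_galoisSubSector)

namespace Summit.KontsevichZagierPeriods.HyperbolicBloch.ZagierDilogarithmCyclotomic

open AbelianSector (isAlgebraic_cyclotomicSum)
open SexticKZ (value_eq_blochWignerDilog)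

/-- **The abelian Dehn-zero sub-sector of Conjecture 1 on ideal tetrahedra, route level** (stub
`stub_abelianKZ_of_milnor` of line `kummer-clausen-linearisation`, reshape c5): GIVEN Dupont 2001
Thm. 10.24 a), Borel's rank theorem for the Bloch group and Milnor's conjecture at level `N`, for the
standard tetrahedral representations `ρ` every `ℤ`-relation `Σ nᵢ · value(ρ zᵢ) = 0` among the periods
`vol T(zᵢ) = D(zᵢ)` of cyclotomic shapes `zᵢ = Σₘ qᵢₘ ζ_Nᵐ ∈ ℍ⁺` with zero Dehn invariant is a KZ
relation: `Σ nᵢ[ρ zᵢ] ∈ KZ.relations` — TetraSector's conclusion on the abelian Dehn-zero sector. Chain: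
`value(ρ zᵢ) = D(zᵢ)` (the volume theorem), `stub_abelianPropagation` (propagation to all Galois twists),
`stub_galoisSubSector` (Galois descent + five-term transfer). [cite: KontsevichZagier2001, §1.2]
[cite: Neumann1998, Thm. 3.2] [cite: Dupont2001, Thm. 10.24 a)] -/
theorem stub_abelianKZ_of_milnor :
    Dupont2001_preBloch_relation_of_invariants → Borel1977_blochGroup_rank_le →
    ∀ (N : ℕ) [NeZero N],
      (∀ m : ZMod N → ℤ, (∀ c, m c ≠ 0 → IsUnit c ∧ 0 < c.val ∧ 2 * c.val < N) →
          ∑ c : ZMod N, (m c : ℝ) *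
              blochWignerDilog (Complex.exp (2 * Real.pi * Complex.I / N) ^ c.val) = 0 →
            ∀ c, m c = 0) →
    ∀ (T : ℂ → Set (Fin 3 → ℝ)), (∀ z, T z = {p | 0 < p 1 ∧ z.re * p 1 < z.im * p 0 ∧
      z.im * (p 0 - 1) < (z.re - 1) * p 1 ∧ 0 < p 2 ∧
      0 < z.im * (p 0 ^ 2 + p 1 ^ 2 + p 2 ^ 2 - p 0) + (z.re - Complex.normSq z) * p 1}) →
    ∀ (ρ : ℂ → KZ.IntegralRep 3), (∀ z, IsAlgebraic ℚ z → 0 < z.im →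
      (ρ z).domain = T z ∧ Set.EqOn (ρ z).integrand (fun p => 1 / p 2 ^ 3) (T z)) →
    ∀ (k : ℕ) (z : Fin k → ℂ) (n : Fin k → ℤ) (q : Fin k → Fin N → ℚ),
      (∀ i, z i = ∑ m : Fin N, (q i m : ℂ) * Complex.exp (2 * Real.pi * Complex.I / N) ^ (m : ℕ)) →
      (∀ i, 0 < (z i).im) →
      (∀ u v : Additive ℂˣ →+ ℚ, dehn u v (∑ i, n i • FreeAbelianGroup.of (z i)) = 0) →
      ∑ i, (n i : ℝ) * (ρ (z i)).value = 0 →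
        (∑ i, n i • KZ.of (ρ (z i))) ∈ KZ.relations := by
  intro hD hB N _ hMil T hT ρ hρ k z n q hz him hdehn hsum
  -- (1) the cyclotomic points are algebraic
  have halg : ∀ i, IsAlgebraic ℚ (z i) := fun i => by
    rw [hz i]
    exact isAlgebraic_cyclotomicSum N (q i)
  -- (2) values are volumes are dilogarithms: `value(ρ zᵢ) = D(zᵢ)`, so `Σ nᵢ D(zᵢ) = 0`
  have hval : ∀ i, (ρ (z i)).value = blochWignerDilog (z i) := fun i =>
    value_eq_blochWignerDilog T hT ρ hρ (halg i) (him i)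
  have hsum' : ∑ i, (n i : ℝ) * blochWignerDilog (z i) = 0 := by
    simpa only [hval] using hsum
  -- (3) abelian propagation (mod Borel rank + Milnor_N), then (4) the Galois sub-sector (mod Dupont)
  exact stub_galoisSubSector hD T hT ρ hρ k z n halg him hdehn
    (stub_abelianPropagation hB N hMil k z n q hz him hdehn hsum')

end Summit.KontsevichZagierPeriods.HyperbolicBloch.ZagierDilogarithmCyclotomic

end
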